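/-
Copyright: harness cell b2b-lgcu-borel (gen 27).  Honest framing: the VALUE here is a THEOREM (the
level-one form of the pair twist law, the exact hypothesis the census evaluator certifies) — NOT summit
progress; the crux item `SubgroupIdentityDesigns` (stmt-MatrixMultiplication-14079) stays open.
-/
import Mathlib
import Summits.MatrixMultiplication.MatrixMultiplication.Theorems.SubgroupIdentityDesigns.Negative.PairTwistLaw
import Summits.MatrixMultiplication.MatrixMultiplication.Theorems.SubgroupIdentityDesigns.Negative.GLmLevelOneCertificates

/-!
# The pair twist law at level one: eigen-twists of every rank-one mode

Route `LevelGradedCohnUmans`, crux `SubgroupIdentityDesigns`, negative side; all primes `p`, all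
dimensions `m`, LEVEL `k = 1`.

At level one the Fourier modes are `M = 0` and the rank-one matrices `M = a bᵀ`
(`exists_eq_vecMulVec_of_rank_le_one_gl`), and `t (a bᵀ) s = (t a)(bᵀ s)`; so `a bᵀ` is fixed by
`(s, t)` as soon as `t a = λ a` and `bᵀ s = μ bᵀ` with `λ μ = 1`.  Feeding this to
`PairTwistLaw.no_design_of_twist₁₃` gives the END-PAIR TEST in the form the level-one census
evaluator checks (`run/shared/lean/b2b/levelgraded-cu/code/g27/rankone_pair.py`):

* `no_levelOne_design_of_eigen_twist₁₃` : let `σ, τ` be linear characters of `H₁, H₃` with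
  `σ s₀ τ t₀ ≠ 1` for some `(s₀, t₀)` (i.e. not both trivial — this disposes of the mode `M = 0`).
  If for every non-zero column `a` and non-zero row `b` there are `s ∈ H₁`, `t ∈ H₃` and scalars
  `λ μ = 1` with `t a = λ a`, `b s = μ b` and `σ s · τ t ≠ 1`, then the subgroup-TPP triple
  `(H₁, H₂, H₃)` carries NO level-one identity design.

(The `-1` case of the SCALAR LAW and the single-subgroup character certificate
`no_levelOne_design_of_character_gl` — `τ` non-trivial on every pointwise stabiliser, `λ = μ = 1`,
`s = 1` — are special cases; the two-sided version lets the eigenvalues of `H₁` on hyperplanes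
enlarge the usable part of the line stabilisers of `H₃`.)  Sorry-free; standard axioms; no new
definitions.  Report: `run/shared/lean/b2b/levelgraded-cu/ORACLE-g27.md` §G27-3.
-/

set_option linter.dupNamespace false

noncomputable section

open scoped BigOperators Classical Matrix

namespace Summit.MatrixMultiplication.MatrixMultiplication.Theorems.SubgroupIdentityDesigns.Negative
namespace PairTwistLaw

open Summit.MatrixMultiplication.MatrixMultiplication.Theorems.LieRankDesigns.Negative (GLm Mat)
open Literature.Barriers.MatrixMultiplication (SubgroupTPP)

variable {p m : ℕ} [hp : Fact p.Prime] {H₁ H₂ H₃ : Subgroup (GLm p m)}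

/-- `t (a bᵀ) s = a bᵀ` when `t a = λ a`, `bᵀ s = μ bᵀ`, `λ μ = 1`. -/
theorem vecMulVec_fixed {a b : Fin m → ZMod p} {S T : Mat p m} {lam mu : ZMod p}
    (hlm : lam * mu = 1) (ha : T *ᵥ a = lam • a) (hb : b ᵥ* S = mu • b) :
    T * Matrix.vecMulVec a b * S = Matrix.vecMulVec a b := by
  rw [Matrix.mul_vecMulVec, Matrix.vecMulVec_mul, ha, hb, Matrix.smul_vecMulVec,
    Matrix.vecMulVec_smul, smul_smul, hlm, one_smul]

/-- **END-PAIR TEST at level one (pair `(H₁, H₃)`).**  See the module docstring. -/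
theorem no_levelOne_design_of_eigen_twist₁₃ (htpp : SubgroupTPP H₁ H₂ H₃) (σ : H₁ →* ℂ)
    (τ : H₃ →* ℂ) (h11 : ∃ s : H₁, ∃ t : H₃, σ s * τ t ≠ 1)
    (hkill : ∀ a : Fin m → ZMod p, a ≠ 0 → ∀ b : Fin m → ZMod p, b ≠ 0 →
      ∃ s : H₁, ∃ t : H₃, ∃ lam mu : ZMod p, lam * mu = 1 ∧
        ((t : GLm p m) : Mat p m) *ᵥ a = lam • a ∧ b ᵥ* ((s : GLm p m) : Mat p m) = mu • b ∧
        σ s * τ t ≠ 1) :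
    ¬ ∃ c : Mat p m → ℂ, (∀ M, 1 < M.rank → c M = 0) ∧
      (∑ M, c M * ZMod.stdAddChar (Matrix.trace (M * ((1 : GLm p m) : Mat p m)))) = 1 ∧
      ∀ x ∈ H₁, ∀ y ∈ H₂, ∀ g ∈ H₃, x * y * g ≠ 1 →
        (∑ M, c M * ZMod.stdAddChar (Matrix.trace (M * ((x * y * g : GLm p m) : Mat p m)))) = 0 := by
  refine no_design_of_twist₁₃ (k := 1) htpp σ τ fun M hM => ?_
  obtain ⟨a, b, rfl⟩ := exists_eq_vecMulVec_of_rank_le_one_gl M hM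
  by_cases hab : a = 0 ∨ b = 0
  · have hM0 : Matrix.vecMulVec a b = 0 := Matrix.vecMulVec_eq_zero.mpr hab
    obtain ⟨s, t, hne⟩ := h11
    refine ⟨s, t, ?_, hne⟩
    rw [hM0, Matrix.mul_zero, Matrix.zero_mul]
  · push Not at hab
    obtain ⟨s, t, lam, mu, hlm, ha, hb, hne⟩ := hkill a hab.1 b hab.2
    exact ⟨s, t, vecMulVec_fixed hlm ha hb, hne⟩

/-- The same test for the pair `(H₁, H₂)` (`t ∈ H₂` acts on columns, `s ∈ H₁` on rows). -/
theorem no_levelOne_design_of_eigen_twist₁₂ (htpp : SubgroupTPP H₁ H₂ H₃) (σ : H₁ →* ℂ)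
    (τ : H₂ →* ℂ) (h11 : ∃ s : H₁, ∃ t : H₂, σ s * τ t ≠ 1)
    (hkill : ∀ a : Fin m → ZMod p, a ≠ 0 → ∀ b : Fin m → ZMod p, b ≠ 0 →
      ∃ s : H₁, ∃ t : H₂, ∃ lam mu : ZMod p, lam * mu = 1 ∧
        ((t : GLm p m) : Mat p m) *ᵥ a = lam • a ∧ b ᵥ* ((s : GLm p m) : Mat p m) = mu • b ∧
        σ s * τ t ≠ 1) :
    ¬ ∃ c : Mat p m → ℂ, (∀ M, 1 < M.rank → c M = 0) ∧
      (∑ M, c M * ZMod.stdAddChar (Matrix.trace (M * ((1 : GLm p m) : Mat p m)))) = 1 ∧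
      ∀ x ∈ H₁, ∀ y ∈ H₂, ∀ g ∈ H₃, x * y * g ≠ 1 →
        (∑ M, c M * ZMod.stdAddChar (Matrix.trace (M * ((x * y * g : GLm p m) : Mat p m)))) = 0 := by
  intro hdes
  obtain ⟨M, hM, hadm⟩ := crux_pair_law₁₂ (k := 1) htpp hdes σ τ
  obtain ⟨a, b, rfl⟩ := exists_eq_vecMulVec_of_rank_le_one_gl M hM
  by_cases hab : a = 0 ∨ b = 0
  · have hM0 : Matrix.vecMulVec a b = 0 := Matrix.vecMulVec_eq_zero.mpr hab
    obtain ⟨s, t, hne⟩ := h11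
    exact hne (hadm s t (by rw [hM0, Matrix.mul_zero, Matrix.zero_mul]))
  · push Not at hab
    obtain ⟨s, t, lam, mu, hlm, ha, hb, hne⟩ := hkill a hab.1 b hab.2
    exact hne (hadm s t (vecMulVec_fixed hlm ha hb))

/-- The same test for the pair `(H₂, H₃)` (`t ∈ H₃` acts on columns, `s ∈ H₂` on rows). -/
theorem no_levelOne_design_of_eigen_twist₂₃ (htpp : SubgroupTPP H₁ H₂ H₃) (σ : H₂ →* ℂ)
    (τ : H₃ →* ℂ) (h11 : ∃ s : H₂, ∃ t : H₃, σ s * τ t ≠ 1)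
    (hkill : ∀ a : Fin m → ZMod p, a ≠ 0 → ∀ b : Fin m → ZMod p, b ≠ 0 →
      ∃ s : H₂, ∃ t : H₃, ∃ lam mu : ZMod p, lam * mu = 1 ∧
        ((t : GLm p m) : Mat p m) *ᵥ a = lam • a ∧ b ᵥ* ((s : GLm p m) : Mat p m) = mu • b ∧
        σ s * τ t ≠ 1) :
    ¬ ∃ c : Mat p m → ℂ, (∀ M, 1 < M.rank → c M = 0) ∧
      (∑ M, c M * ZMod.stdAddChar (Matrix.trace (M * ((1 : GLm p m) : Mat p m)))) = 1 ∧
      ∀ x ∈ H₁, ∀ y ∈ H₂, ∀ g ∈ H₃, x * y * g ≠ 1 →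
        (∑ M, c M * ZMod.stdAddChar (Matrix.trace (M * ((x * y * g : GLm p m) : Mat p m)))) = 0 := by
  intro hdes
  obtain ⟨M, hM, hadm⟩ := crux_pair_law₂₃ (k := 1) htpp hdes σ τ
  obtain ⟨a, b, rfl⟩ := exists_eq_vecMulVec_of_rank_le_one_gl M hM
  by_cases hab : a = 0 ∨ b = 0
  · have hM0 : Matrix.vecMulVec a b = 0 := Matrix.vecMulVec_eq_zero.mpr hab
    obtain ⟨s, t, hne⟩ := h11
    exact hne (hadm s t (by rw [hM0, Matrix.mul_zero, Matrix.zero_mul]))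
  · push Not at hab
    obtain ⟨s, t, lam, mu, hlm, ha, hb, hne⟩ := hkill a hab.1 b hab.2
    exact hne (hadm s t (vecMulVec_fixed hlm ha hb))

end PairTwistLaw
end Summit.MatrixMultiplication.MatrixMultiplication.Theorems.SubgroupIdentityDesigns.Negative
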